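import Mathlib
import Literature.Analysis.FluidPDE.TaoLocalisationHolds
import Literature.Analysis.FluidPDE.TaoLocalisationProofs
import Literature.Analysis.FluidPDE.EnergyToolkit
import Summits.NavierStokesRegularity.NavierStokesRegularity.Theorems.LevelSetModerationHighSpeedPressureWorkSliceDecay

/-!
# Crux `SlicedKelvin.PlanarFluxAPriori` (stmt-NavierStokesRegularity-15600), line `registered`,
# stub `stub_decayPersistence` — bounds on closed slabs for the solution and its derivatives

Support file (theorems only). For a classical solution of the unforced Navier–Stokes system
(`ν > 0`) on `ℝ³ × [0, T)`, Leray–Hopf from its rapidly decaying datum, Tao's theorem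
(`tao2011_hasBoundedSobolevNormsOn_holds`, Cor. 11.1: `u ∈ L^∞_t H^k_x` on closed slabs; already
landed in this form as `levelSetModeration_hasBoundedSobolevNormsOn_slab`) and the Sobolev
imbedding `H² ⊂ C_B` (`exists_enorm_le_sobolev_two_two_dim_three`) bound every nested directional
derivative `∂_{v_m} ⋯ ∂_{v_1} u` of order `m ≤ 3` (unit directions), together with its spatial
derivative, uniformly on `[0, T₁] × ℝ³`, `T₁ < T`; at `t = 0` these fields carry the cubic
weight by the rapid decay of the datum (`decay_field_package`). Such fields are tracked
abstractly through the pointwise domination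
`‖Dʲ(G τ)(y)‖ ≤ ‖D^{j+m}(u τ)(y)‖` for all `j`, which is preserved by one more unit directional
derivative (`decay_P_dirDeriv`). Bookkeeping lemmas for the assembly of the stub: re-indexing of
the Leibniz-expanded Duhamel terms over `ι ⊕ ι`, the nested form of `D³`, `D²`, `D¹`, and the
operator norm of a multilinear map from its values on unit vectors.

## References

* T. Tao, Anal. PDE 6 (2013) = arXiv:1108.1165, Cor. 11.1. [Tao2011]
* R. A. Adams, *Sobolev Spaces* (1975), Thm. 5.4. [Adams1975]
-/

noncomputable section

-- the summit and its single sub-problem share the name (CONVENTIONS §1), as in every Theorems file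
set_option linter.dupNamespace false

namespace Summit.NavierStokesRegularity.NavierStokesRegularity.Theorems.SlicedKelvinPlanarFluxAPriori

open MeasureTheory Set Filter Topology Metric Real Function
open scoped ENNReal NNReal ContDiff
open Literature.Analysis.FluidPDE

/-! ### Pointwise domination of iterated derivatives under one directional derivative -/

/-- **One more directional derivative.** If `‖Dʲ G (y)‖ ≤ A ‖D^{j+m} f (y)‖` for all `j`, `y`
(`G` smooth), then `‖Dʲ (∂_v G)(y)‖ ≤ A ‖v‖ ‖D^{j+(m+1)} f (y)‖` for all `j`, `y`
(`norm_iteratedFDeriv_clm_apply_const` and `norm_iteratedFDeriv_fderiv`). -/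
theorem decay_iteratedFDeriv_dirDeriv_le {F : Type*} [NormedAddCommGroup F] [NormedSpace ℝ F]
    {f : EuclideanSpace ℝ (Fin 3) → F} {G : EuclideanSpace ℝ (Fin 3) → EuclideanSpace ℝ (Fin 3)}
    (hG : ContDiff ℝ ∞ G) {m : ℕ} {A : ℝ}
    (h : ∀ (j : ℕ) (y : EuclideanSpace ℝ (Fin 3)),
      ‖iteratedFDeriv ℝ j G y‖ ≤ A * ‖iteratedFDeriv ℝ (j + m) f y‖)
    (v : EuclideanSpace ℝ (Fin 3)) (j : ℕ) (y : EuclideanSpace ℝ (Fin 3)) :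
    ‖iteratedFDeriv ℝ j (fun z => fderiv ℝ G z v) y‖ ≤ (A * ‖v‖) * ‖iteratedFDeriv ℝ (j + (m + 1)) f y‖ := by
  have hc : ContDiff ℝ ∞ (fderiv ℝ G) := hG.fderiv_right (by simp)
  have h1 : ‖iteratedFDeriv ℝ j (fun z => fderiv ℝ G z v) y‖ ≤ ‖v‖ * ‖iteratedFDeriv ℝ j (fderiv ℝ G) y‖ :=
    norm_iteratedFDeriv_clm_apply_const (hc.contDiffAt) (by exact_mod_cast le_top)
  have h2 : ‖iteratedFDeriv ℝ j (fderiv ℝ G) y‖ = ‖iteratedFDeriv ℝ (j + 1) G y‖ :=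
    norm_iteratedFDeriv_fderiv
  have h3 := h (j + 1) y
  have h4 : j + 1 + m = j + (m + 1) := by omega
  rw [h4] at h3
  calc ‖iteratedFDeriv ℝ j (fun z => fderiv ℝ G z v) y‖
      ≤ ‖v‖ * ‖iteratedFDeriv ℝ (j + 1) G y‖ := by rw [← h2]; exact h1
    _ ≤ ‖v‖ * (A * ‖iteratedFDeriv ℝ (j + (m + 1)) f y‖) := mul_le_mul_of_nonneg_left h3 (norm_nonneg _)
    _ = (A * ‖v‖) * ‖iteratedFDeriv ℝ (j + (m + 1)) f y‖ := by ring

/-- **Time-dependent form with joint smoothness.** For a field `G` jointly smooth on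
`[0, T) × ℝ³` whose slices are dominated by `u`, `‖Dʲ(G τ)(y)‖ ≤ ‖D^{j+m}(u τ)(y)‖`, and a
direction `‖v‖ ≤ 1`, the field `∂_v G` is jointly smooth on `[0, T) × ℝ³` and dominated at order
`m + 1`. -/
theorem decay_P_dirDeriv {T : ℝ} {u G : ℝ → EuclideanSpace ℝ (Fin 3) → EuclideanSpace ℝ (Fin 3)}
    (hG : IsSmoothSpaceTimeOn (Ico 0 T) G) {m : ℕ}
    (hP : ∀ τ ∈ Ico 0 T, ∀ (j : ℕ) (y : EuclideanSpace ℝ (Fin 3)),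
      ‖iteratedFDeriv ℝ j (G τ) y‖ ≤ ‖iteratedFDeriv ℝ (j + m) (u τ) y‖)
    {v : EuclideanSpace ℝ (Fin 3)} (hv : ‖v‖ ≤ 1) :
    IsSmoothSpaceTimeOn (Ico 0 T) (fun τ y => fderiv ℝ (G τ) y v) ∧
      ∀ τ ∈ Ico 0 T, ∀ (j : ℕ) (y : EuclideanSpace ℝ (Fin 3)),
        ‖iteratedFDeriv ℝ j (fun z => fderiv ℝ (G τ) z v) y‖ ≤ ‖iteratedFDeriv ℝ (j + (m + 1)) (u τ) y‖ := by
  refine ⟨hG.fderiv_slice_apply (uniqueDiffOn_Ico 0 T) v, fun τ hτ j y => ?_⟩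
  have hGτ : ContDiff ℝ ∞ (G τ) := hG.contDiff_slice hτ
  have hP' : ∀ (j : ℕ) (y : EuclideanSpace ℝ (Fin 3)),
      ‖iteratedFDeriv ℝ j (G τ) y‖ ≤ 1 * ‖iteratedFDeriv ℝ (j + m) (u τ) y‖ := fun j y => by
    rw [one_mul]; exact hP τ hτ j y
  have h := decay_iteratedFDeriv_dirDeriv_le hGτ hP' v j y
  refine h.trans ?_
  have : 1 * ‖v‖ ≤ 1 := by rw [one_mul]; exact hv
  exact (mul_le_mul_of_nonneg_right this (norm_nonneg _)).trans (by rw [one_mul])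

/-! ### Sup bounds from the Sobolev imbedding -/

/-- **Sup bound of a dominated field.** If `‖Dʲ G‖ ≤ A ‖D^{j+m} f‖` pointwise for `j ≤ 2`,
the `L²` norms of `Dⁿ f` are bounded by `C n` and `K` is a Sobolev constant for `H² ⊂ C_B` on
`ℝ³`, then `‖G y‖ ≤ A K Σ_{j<3} (C (j+m))^{1/2}`. -/
theorem decay_norm_le_of_sobolev {F : Type*} [NormedAddCommGroup F] [NormedSpace ℝ F]
    {K : ℝ≥0∞} (hK : K < ⊤)
    (hS : ∀ g : EuclideanSpace ℝ (Fin 3) → EuclideanSpace ℝ (Fin 3), ContDiff ℝ 2 g →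
      ∀ x, ‖g x‖ₑ ≤ K * ∑ j ∈ Finset.range 3, eLpNorm (iteratedFDeriv ℝ j g) 2 volume)
    {f : EuclideanSpace ℝ (Fin 3) → F} {C : ℕ → ℝ≥0}
    (hC : ∀ n, ∫⁻ y, ‖iteratedFDeriv ℝ n f y‖ₑ ^ 2 ≤ C n)
    {G : EuclideanSpace ℝ (Fin 3) → EuclideanSpace ℝ (Fin 3)} (hG : ContDiff ℝ 2 G) {m : ℕ} {A : ℝ}
    (hA : 0 ≤ A) (h : ∀ (j : ℕ) (y : EuclideanSpace ℝ (Fin 3)),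
      ‖iteratedFDeriv ℝ j G y‖ ≤ A * ‖iteratedFDeriv ℝ (j + m) f y‖)
    (y : EuclideanSpace ℝ (Fin 3)) :
    ‖G y‖ ≤ A * (K * ∑ j ∈ Finset.range 3, ((C (j + m) : ℝ≥0∞) ^ (1 / 2 : ℝ))).toReal := by
  set R : ℝ≥0∞ := K * ∑ j ∈ Finset.range 3, ((C (j + m) : ℝ≥0∞) ^ (1 / 2 : ℝ)) with hR
  have hRtop : R < ⊤ := by
    refine ENNReal.mul_lt_top hK (ENNReal.sum_lt_top.2 fun j _ => ?_)
    exact ENNReal.rpow_lt_top_of_nonneg (by norm_num) ENNReal.coe_ne_top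
  -- `‖Dʲ G‖_{L²} ≤ ofReal A · C_{j+m}^{1/2}`
  have hL2 : ∀ j, eLpNorm (iteratedFDeriv ℝ j G) 2 volume ≤
      ENNReal.ofReal A * (C (j + m) : ℝ≥0∞) ^ (1 / 2 : ℝ) := by
    intro j
    have h1 : eLpNorm (iteratedFDeriv ℝ j G) 2 volume ≤
        eLpNorm (fun z => A * ‖iteratedFDeriv ℝ (j + m) f z‖) 2 volume := by
      refine eLpNorm_mono fun z => ?_
      rw [Real.norm_of_nonneg (mul_nonneg hA (norm_nonneg _))]
      exact h j z
    have h2 : eLpNorm (fun z => A * ‖iteratedFDeriv ℝ (j + m) f z‖) 2 volume =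
        ENNReal.ofReal A * eLpNorm (iteratedFDeriv ℝ (j + m) f) 2 volume := by
      have : (fun z => A * ‖iteratedFDeriv ℝ (j + m) f z‖) = A • fun z => ‖iteratedFDeriv ℝ (j + m) f z‖ := by
        funext z; simp [smul_eq_mul]
      rw [this, eLpNorm_const_smul, eLpNorm_norm, Real.enorm_eq_ofReal hA]
    rw [h2] at h1
    exact h1.trans (mul_le_mul_right (eLpNorm_two_le_rpow_of_lintegral_sq_le (hC (j + m))) _)
  have h1 : ‖G y‖ₑ ≤ ENNReal.ofReal A * R := by
    calc ‖G y‖ₑ ≤ K * ∑ j ∈ Finset.range 3, eLpNorm (iteratedFDeriv ℝ j G) 2 volume := hS G hG y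
      _ ≤ K * ∑ j ∈ Finset.range 3, ENNReal.ofReal A * (C (j + m) : ℝ≥0∞) ^ (1 / 2 : ℝ) :=
          mul_le_mul_right (Finset.sum_le_sum fun j _ => hL2 j) K
      _ = ENNReal.ofReal A * R := by rw [hR, ← Finset.mul_sum]; ring
  have h2 : ENNReal.ofReal A * R ≠ ⊤ := ENNReal.mul_ne_top ENNReal.ofReal_ne_top hRtop.ne
  calc ‖G y‖ = (‖G y‖ₑ).toReal := (toReal_enorm _).symm
    _ ≤ (ENNReal.ofReal A * R).toReal := ENNReal.toReal_mono h2 h1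
    _ = A * R.toReal := by rw [ENNReal.toReal_mul, ENNReal.toReal_ofReal hA]

/-! ### The package of bounds for dominated fields of a classical Leray–Hopf solution -/

/-- **Bounds on closed slabs for the nested derivatives of a classical Leray–Hopf solution.**
For `ν > 0`, a classical solution of the unforced system on `ℝ³ × [0, T)`, Leray–Hopf from its
rapidly decaying datum, and `T₁ ∈ (0, T)`, there are `L, D ≥ 0` such that every field `G`,
jointly smooth on `[0, T) × ℝ³` and dominated at some order `m ≤ 3`
(`‖Dʲ(G τ)(y)‖ ≤ ‖D^{j+m}(u τ)(y)‖`; e.g. `∂_{v_m}⋯∂_{v_1}u` with unit `vᵢ`), satisfies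
`‖G(τ,y)‖ ≤ L`, `‖D(G τ)(y)‖ ≤ L` on `[0, T₁] × ℝ³` and `(1 + |y|)³ ‖G(0,y)‖ ≤ D` (Tao 2013,
Cor. 11.1 on the closed slab; Sobolev imbedding; rapid decay of the datum). -/
theorem decay_field_package :
    ∀ {ν T : ℝ} (hν : 0 < ν) {u : ℝ → EuclideanSpace ℝ (Fin 3) → EuclideanSpace ℝ (Fin 3)}
    {p : ℝ → EuclideanSpace ℝ (Fin 3) → ℝ}
    (hcl : Literature.Analysis.FluidPDE.IsClassicalNSSolutionOn (Set.Ico 0 T) ν 0 u p)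
    (hLH : Literature.Analysis.FluidPDE.IsLerayHopfOn T ν 0 (u 0) u)
    (hdec : Literature.Analysis.FluidPDE.HasRapidSpatialDecay (u 0)) {T₁ : ℝ} (hT₁ : T₁ ∈ Set.Ioo 0 T),
    ∃ L D : ℝ, 0 ≤ L ∧ 0 ≤ D ∧
      ∀ (G : ℝ → EuclideanSpace ℝ (Fin 3) → EuclideanSpace ℝ (Fin 3)) (m : ℕ), m ≤ 3 →
        Literature.Analysis.FluidPDE.IsSmoothSpaceTimeOn (Set.Ico 0 T) G →
        (∀ τ ∈ Set.Ico 0 T, ∀ (j : ℕ) (y : EuclideanSpace ℝ (Fin 3)),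
          ‖iteratedFDeriv ℝ j (G τ) y‖ ≤ ‖iteratedFDeriv ℝ (j + m) (u τ) y‖) →
        (∀ τ ∈ Set.Icc 0 T₁, ∀ y, ‖G τ y‖ ≤ L ∧ ‖fderiv ℝ (G τ) y‖ ≤ L) ∧
          (∀ y, (1 + ‖y‖) ^ 3 * ‖G 0 y‖ ≤ D) := by
  intro ν T hν u p hcl hLH hdec T₁ hT₁
  -- Sobolev data on the closed slab
  have hH := levelSetModeration_hasBoundedSobolevNormsOn_slab hν hcl hLH hdec hT₁
  choose C hC using hH
  obtain ⟨K, hK, hS⟩ := Literature.Analysis.FunctionSpaces.exists_enorm_le_sobolev_two_two_dim_three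
    (E := EuclideanSpace ℝ (Fin 3)) (F := EuclideanSpace ℝ (Fin 3))
    (volume : Measure (EuclideanSpace ℝ (Fin 3))) finrank_euclideanSpace_fin
  -- the sup constants `L m'`, `m' ≤ 4`
  set Lm : ℕ → ℝ := fun m' => (K * ∑ j ∈ Finset.range 3, ((C (j + m') : ℝ≥0∞) ^ (1 / 2 : ℝ))).toReal
    with hLm
  have hLm0 : ∀ m', 0 ≤ Lm m' := fun m' => ENNReal.toReal_nonneg
  set L : ℝ := ∑ m' ∈ Finset.range 5, Lm m' with hL
  have hL0 : 0 ≤ L := Finset.sum_nonneg fun m' _ => hLm0 m'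
  have hLmL : ∀ m' < 5, Lm m' ≤ L := fun m' hm' =>
    Finset.single_le_sum (fun i _ => hLm0 i) (Finset.mem_range.2 hm')
  -- the decay constants `Dm m'`, `m' ≤ 3`
  choose Dm hDm using fun n : ℕ => hdec n 3
  set D : ℝ := ∑ m' ∈ Finset.range 4, max (Dm m') 0 with hD
  have hD0 : 0 ≤ D := Finset.sum_nonneg fun m' _ => le_max_right _ _
  have hDmD : ∀ m' < 4, Dm m' ≤ D := fun m' hm' =>
    (le_max_left _ _).trans (Finset.single_le_sum (fun i _ => le_max_right (Dm i) 0) (Finset.mem_range.2 hm'))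
  refine ⟨L, D, hL0, hD0, fun G m hm hG hP => ⟨fun τ hτ y => ?_, fun y => ?_⟩⟩
  · have hτ' : τ ∈ Ico 0 T := ⟨hτ.1, hτ.2.trans_lt hT₁.2⟩
    have hGτ : ContDiff ℝ ∞ (G τ) := hG.contDiff_slice hτ'
    have hC' : ∀ n, ∫⁻ z, ‖iteratedFDeriv ℝ n (u τ) z‖ₑ ^ 2 ≤ C n := fun n => hC n τ hτ
    constructor
    · -- the value
      have hP' : ∀ (j : ℕ) (z : EuclideanSpace ℝ (Fin 3)),
          ‖iteratedFDeriv ℝ j (G τ) z‖ ≤ 1 * ‖iteratedFDeriv ℝ (j + m) (u τ) z‖ := fun j z => by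
        rw [one_mul]; exact hP τ hτ' j z
      have h := decay_norm_le_of_sobolev hK hS hC' (hGτ.of_le (by norm_cast))
        zero_le_one hP' y
      rw [one_mul] at h
      exact h.trans (hLmL m (by omega))
    · -- the derivative, through unit directions
      refine ContinuousLinearMap.opNorm_le_bound _ hL0 fun v => ?_
      have hP' : ∀ (j : ℕ) (z : EuclideanSpace ℝ (Fin 3)),
          ‖iteratedFDeriv ℝ j (G τ) z‖ ≤ 1 * ‖iteratedFDeriv ℝ (j + m) (u τ) z‖ := fun j z => by
        rw [one_mul]; exact hP τ hτ' j z
      have hPv := decay_iteratedFDeriv_dirDeriv_le hGτ hP' v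
      have hc1 : ContDiff ℝ ∞ (fderiv ℝ (G τ)) := hGτ.fderiv_right (by simp)
      have hGv : ContDiff ℝ 2 (fun z => fderiv ℝ (G τ) z v) :=
        (hc1.clm_apply contDiff_const).of_le (by norm_cast)
      have h := decay_norm_le_of_sobolev hK hS hC' hGv (by positivity : (0 : ℝ) ≤ 1 * ‖v‖) hPv y
      calc ‖fderiv ℝ (G τ) y v‖ ≤ 1 * ‖v‖ * Lm (m + 1) := h
        _ ≤ 1 * ‖v‖ * L := mul_le_mul_of_nonneg_left (hLmL (m + 1) (by omega)) (by positivity)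
        _ = L * ‖v‖ := by ring
  · -- decay at `t = 0`
    have h0 : (0 : ℝ) ∈ Ico 0 T := ⟨le_rfl, hT₁.1.trans hT₁.2⟩
    have h1 : ‖G 0 y‖ ≤ ‖iteratedFDeriv ℝ m (u 0) y‖ := by
      have h := hP 0 h0 0 y
      rwa [norm_iteratedFDeriv_zero, zero_add] at h
    calc (1 + ‖y‖) ^ 3 * ‖G 0 y‖ ≤ (1 + ‖y‖) ^ 3 * ‖iteratedFDeriv ℝ m (u 0) y‖ :=
          mul_le_mul_of_nonneg_left h1 (by positivity)
      _ ≤ Dm m := hDm m y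
      _ ≤ D := hDmD m (by omega)

/-! ### Bookkeeping for the assembly -/

/-- Re-indexing of the Leibniz-expanded Duhamel terms over `ι ⊕ ι`. -/
theorem decay_sum_elim_reindex {ι : Type} [Fintype ι] {α β : Type*} [AddCommMonoid β]
    (B : α → α → β) (a b a' b' : ι → α) :
    ∑ j : ι ⊕ ι, B (Sum.elim a' a j) (Sum.elim b b' j) = ∑ i, (B (a' i) (b i) + B (a i) (b' i)) := by
  rw [Fintype.sum_sum_type, Finset.sum_add_distrib]
  simp

/-- The nested form of the third derivative: `D³f(x)(m₀, m₁, m₂) = ∂_{m₀} ∂_{m₁} ∂_{m₂} f (x)`. -/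
theorem decay_iteratedFDeriv_three_apply {F : Type*} [NormedAddCommGroup F] [NormedSpace ℝ F]
    {f : EuclideanSpace ℝ (Fin 3) → F} (hf : ContDiff ℝ ∞ f) (x : EuclideanSpace ℝ (Fin 3))
    (m : Fin 3 → EuclideanSpace ℝ (Fin 3)) :
    iteratedFDeriv ℝ 3 f x m =
      fderiv ℝ (fun y => fderiv ℝ (fun z => fderiv ℝ f z (m 2)) y (m 1)) x (m 0) := by
  have h1 : ContDiff ℝ ∞ (fun y => fderiv ℝ f y) := hf.fderiv_right (by simp)
  have h2 : ContDiff ℝ ∞ (fun z => fderiv ℝ f z (m (Fin.last 2))) := h1.clm_apply contDiff_const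
  have h3 : ContDiff ℝ ∞ (fun y => fderiv ℝ (fun z => fderiv ℝ f z (m (Fin.last 2))) y) :=
    h2.fderiv_right (by simp)
  rw [iteratedFDeriv_succ_apply_right,
    ← iteratedFDeriv_clm_apply_const_apply h1 (by norm_cast),
    iteratedFDeriv_succ_apply_right,
    ← iteratedFDeriv_clm_apply_const_apply h3 (by norm_cast),
    iteratedFDeriv_one_apply]
  rfl

/-- The nested form of the second derivative: `D²f(x)(m₀, m₁) = ∂_{m₀} ∂_{m₁} f (x)`. -/
theorem decay_iteratedFDeriv_two_apply {F : Type*} [NormedAddCommGroup F] [NormedSpace ℝ F]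
    {f : EuclideanSpace ℝ (Fin 3) → F} (hf : ContDiff ℝ ∞ f) (x : EuclideanSpace ℝ (Fin 3))
    (m : Fin 2 → EuclideanSpace ℝ (Fin 3)) :
    iteratedFDeriv ℝ 2 f x m = fderiv ℝ (fun z => fderiv ℝ f z (m 1)) x (m 0) := by
  have h1 : ContDiff ℝ ∞ (fun y => fderiv ℝ f y) := hf.fderiv_right (by simp)
  rw [iteratedFDeriv_succ_apply_right,
    ← iteratedFDeriv_clm_apply_const_apply h1 (by norm_cast),
    iteratedFDeriv_one_apply]
  rfl

/-- **Operator norm from unit vectors**: a continuous multilinear map bounded by `C ≥ 0` on tuples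
of unit vectors has norm at most `C`. -/
theorem decay_opNorm_le_of_unit {k : ℕ} {F : Type*} [NormedAddCommGroup F] [NormedSpace ℝ F]
    (M : ContinuousMultilinearMap ℝ (fun _ : Fin k => EuclideanSpace ℝ (Fin 3)) F) {C : ℝ}
    (hC : 0 ≤ C) (h : ∀ m : Fin k → EuclideanSpace ℝ (Fin 3), (∀ i, ‖m i‖ = 1) → ‖M m‖ ≤ C) :
    ‖M‖ ≤ C := by
  refine ContinuousMultilinearMap.opNorm_le_bound hC fun m => ?_
  by_cases hz : ∃ i, m i = 0
  · obtain ⟨i, hi⟩ := hz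
    rw [M.map_coord_zero i hi, norm_zero]
    positivity
  · push Not at hz
    set c : Fin k → ℝ := fun i => ‖m i‖ with hc
    set m' : Fin k → EuclideanSpace ℝ (Fin 3) := fun i => (‖m i‖)⁻¹ • m i with hm'
    have hcpos : ∀ i, 0 < c i := fun i => norm_pos_iff.2 (hz i)
    have hunit : ∀ i, ‖m' i‖ = 1 := fun i => by
      rw [hm']; dsimp only
      rw [norm_smul, norm_inv, norm_norm, inv_mul_cancel₀ (hcpos i).ne']
    have hm : m = fun i => c i • m' i := by
      funext i
      rw [hm', hc]; dsimp only
      rw [smul_smul, mul_inv_cancel₀ (hcpos i).ne', one_smul]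
    have hprod : 0 ≤ ∏ i, c i := Finset.prod_nonneg fun i _ => (hcpos i).le
    calc ‖M m‖ = ‖M fun i => c i • m' i‖ := by rw [← hm]
      _ = ‖(∏ i, c i) • M m'‖ := by rw [M.map_smul_univ]
      _ = (∏ i, c i) * ‖M m'‖ := by rw [norm_smul, Real.norm_of_nonneg hprod]
      _ ≤ (∏ i, c i) * C := mul_le_mul_of_nonneg_left (h m' hunit) hprod
      _ = C * ∏ i, ‖m i‖ := by rw [hc, mul_comm]

end Summit.NavierStokesRegularity.NavierStokesRegularity.Theorems.SlicedKelvinPlanarFluxAPriori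

end
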